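import Literature.MathematicalPhysics.QuantumFieldTheory.Balaban1983to89.B9Eq3117DivHessOpGaugeMode
import Literature.MathematicalPhysics.QuantumFieldTheory.Balaban1983to89.B9Eq33CovDerivLocalLetterTower

/-!
# `Balaban1983to89.B9Eq3117GaugeModeStencilLettersTower` — T. Bałaban, *Propagators for lattice gauge theories in a background field*, Commun. Math. Phys. **99** (1985)
# 389–434 [Balaban1985BackgroundPropagators] (3.117) p. 419, (3.120) p. 419, (3.36) p. 396, Thm 3.1 (3.42) p. 397 (*«for x ∈ Δ(y), supp λ ⊂ Δ(y′)»*), p. 421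
# (*«each operator Δ′_π provides the small factor α₀»*): **THE TWO SMALL LETTERS OF THE (3.130) TRANSFER — `(L)(Δ^η(U)∘D_U; 2M_φM_φ′j₀e^κ, κ)` (sites → bonds) AND
# `(L)(D*_U∘Δ^η(U); 2d·M_φM_φ′j₀e^κ, κ)` (bonds → sites), AT EVERY RATE `κ ≥ 0`, OVER ANY BLOCK MAP WITH ADJACENT BOND ENDS AND OVER THE BIG BLOCKS OF THE
# TOWER** — the hypotheses `hM`, `hMt` of this lineage's (K72) `B9Eq3130TransferPairLetters.transfer_pair` in its exact shape, read off the NE9 owner's operator form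
# of (3.117) (`B9Eq3117HessOpGaugeMode`) and its transpose (the OWNER's `B9Eq3117DivHessOpGaugeMode`) under print's third window `‖J(b)‖ ≤ j₀` ((3.36))

statement-level skeleton of published theorems with citation tags; proofs where landed; nothing here is a claim about the Yang–Mills mass gap

CITATION HEADER (lean-in-tree rule).  Audit cell `pub-balaban`, sub-cell `t4`, BINDER row NE9; filed by NE9 crux-team LEAF PROVER 05
(`b2b-balaban-t4-ne9-formalise-leaf-05`, gen 88; INTENT-PLAN (K75), journal `HOME/CLAIMS.log` l.66044; PLAN v15 (b), R-ne9p1-g97-1 l.65987).  Composed BY NAME from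
the row OWNER t4-ne9-p1 g97's `B9Eq3117HessOpGaugeMode.norm_equiv_hessOp_covDerivL2K_le` ∕ `equiv_hessOp_covDerivL2K_eq_zero` (the stencil `Δ∘D_U`) and
`B9Eq3117DivHessOpGaugeMode.norm_equiv_covDivL2K_hessOp_le` (its transpose `D*_U∘Δ`), and ne9-leaf-03's `B9Eq33CovDerivLocalLetterTower.tdist_bigBlock_bpos_btgt_le_one`
(the adjacency letter of the big-block map); the case bookkeeping is ne9-leaf-03's `local_covDeriv_of_blockMap` ∕ `local_covDiv_of_blockMap` pattern, [folklore].  Source READ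
first-hand this generation (`paper:balaban1985-cmp99-background-propagators`, journal page = PDF page + 388): pp. 392, 396–397, 418–422.

WHAT IS PROVED (sorry-free; proof lane — no `def`; [folklore] one-bond range bookkeeping).  Under the OWNER's hypotheses (`c₀ = η^d`, `η ≠ 0`, unitary `U(b) ∈ U1`,
`*`-trace `τ`, norming `⟨φ⁻¹X, φ⁻¹Y⟩ = τ(X*Y)`, `‖φw‖ ≤ M_φ‖w‖`, `‖φ⁻¹X‖ ≤ M_φ′‖X‖`, `‖J(b)‖ ≤ j₀`):
* §1 (any block map `π : T_P → T_m` with `d_m(π(b₋), π(b₊)) ≤ 1`) **`local_hessOp_covDerivL2K_of_blockMap`** — for `λ` supported over `π⁻¹(v)` with `‖λ‖_∞ ≤ F`: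
  `‖(Δ^η(U)D_Uλ)(b)‖ ≤ 2M_φM_φ′j₀·e^κ·e^{−κ d_m(π(b₋), v)}·F`; **`local_covDivL2K_hessOp_of_blockMap`** — for `A` supported over the bonds with `π(b₋) = v`, `‖A‖_∞ ≤ F`:
  `‖(D*_U(Δ^η(U)A))(y)‖ ≤ 2d·M_φM_φ′j₀·e^κ·e^{−κ d_m(π(y), v)}·F`.
* §2 (the tower `T_{(L^k m)}`, `Π = blockCoord (L^k) m ∘ siteCast`, bonds read at `b₋`) **`local_hessOp_covDerivL2K_tower`**, **`local_covDivL2K_hessOp_tower`** — the same two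
  letters: EXACTLY the hypotheses `hM` (`ε₁ = 2M_φM_φ′j₀e^κ`) and `hMt` (`ε₂ = 2d·M_φM_φ′j₀e^κ`) of (K72) `transfer_pair` at `Y = T_m`, `δ = d_m`, `π_S = Π`, `π_B = Π∘bpos`.
HONEST SCOPE.  [folklore]; `‖J‖ ≤ j₀` ((3.36)) is a HYPOTHESIS of printed shape; `j₀` is NOT valued here (print: `O(1)Mα₀` at the top scale); nothing of [B9] (3.36) ∕ (3.130)–(3.133)
∕ Thm 3.1 ∕ 3.3 ∕ 3.13 or [B11] (117) asserted, valued or discharged; «NE9 ⇐ the named binders»; NE9 NOT PRINTED ∕ NOT PROVED; row WALLED ON A MODEL (O-NE9-1; #5 UNRULED);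
spine PROVED 0∕9; rung (B)+1 on a finite T⁴ — NOT infinite volume, NOT mass gap, NOT BetaPertH, NOT Clay.  HONEST DEPENDENCY: continuum YM on T⁴ ⇐ BetaPertH ∧ nine spine
estimates (0/9 proved); BetaPertH ⇐ (D1) ∧ (D4) ∧ CAP+tail; G-an2-4 gates asym, D1 and NE2/3/4.  NEW file importing the OWNER's `B9Eq3117DivHessOpGaugeMode` and ne9-leaf-03's
`B9Eq33CovDerivLocalLetterTower`; nothing modified.  Net new unproved facts: 0.
-/

noncomputable section

set_option autoImplicit false

open scoped InnerProductSpace ComplexConjugate BigOperators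

namespace Literature.MathematicalPhysics.QuantumFieldTheory.Balaban1983to89.B9Eq3117GaugeModeStencilLettersTower

open B9SectCLatticeCarrier (Bond bpos btgt shift unshift shift_unshift unshift_shift)
open B4Sect5Torus (TSite tdist tdist_nonneg tdist_self tdist_symm)
open B9Eq311L2Pairing (WL2)
open B11Eq103H1Complex (BondL2K SiteL2K covDerivL2K covDivL2K)
open B9Eq310HessianOperator (adTransportW hessOp)
open B9Eq319QprimeTorus (blockCoord)
open B9Eq315QTower (towerP)
open B9Eq316TowerFlatIsOneStep (towerP_eq_fineP_pow siteCast)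
open B9Eq3117HessOpGaugeMode (norm_equiv_hessOp_covDerivL2K_le equiv_hessOp_covDerivL2K_eq_zero)
open B9Eq3117DivHessOpGaugeMode (norm_equiv_covDivL2K_hessOp_le)
open B9Eq33CovDerivLocalLetterTower (tdist_bigBlock_bpos_btgt_le_one)
open B7Prop1Explicit (U1)

/-! ## §1 Over any block map whose bond ends are adjacent -/

section BlockMap

variable {d : ℕ} {P : Fin d → ℕ} {m : Fin d → ℕ} {𝔸 : Type*} [NormedRing 𝔸] [NormedAlgebra ℂ 𝔸] [NormOneClass 𝔸] [StarRing 𝔸] [StarModule ℂ 𝔸]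
  {W : Type*} [NormedAddCommGroup W] [InnerProductSpace ℂ W] [FiniteDimensional ℂ W] (φ : W ≃ₗ[ℂ] 𝔸) {c₀ : ℝ} [Fact (0 < c₀)]
  (τ : 𝔸 →ₗ[ℂ] ℂ) (hτ₂ : ∀ X Y : 𝔸, τ (X * Y) = τ (Y * X))
  (hφ : ∀ X Y : 𝔸, ⟪φ.symm X, φ.symm Y⟫_ℂ = τ (star X * Y)) {η : ℝ} (hη : η ≠ 0) {U : Bond d P → 𝔸ˣ}
  (hU : ∀ b, star (U b : 𝔸) = ((U b)⁻¹ : 𝔸ˣ)) (hc₀ : c₀ = η ^ d) (hUb : ∀ b, U b ∈ U1 𝔸)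
  {Mφ Mφ' j₀ : ℝ} (hMφ : 0 ≤ Mφ) (hMφ' : 0 ≤ Mφ') (hφn : ∀ w, ‖φ w‖ ≤ Mφ * ‖w‖) (hφ' : ∀ X, ‖φ.symm X‖ ≤ Mφ' * ‖X‖)
  (hJ : ∀ μ y, ‖B9Eq39Adjoint.J (fun μ => B9Eq33CovDerivVector.shiftEquiv μ) (fun μ y => U (y, μ)) η μ y‖ ≤ j₀)
  (π : TSite d P → TSite d m)

/-- `C·F ≤ C·e^κ·e^{−κD}·F` when `0 ≤ C`, `0 ≤ F`, `0 ≤ κ` and `D ≤ 1` (the one-block range bookkeeping). [folklore] -/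
private theorem le_exp_mul_exp {C F κ D : ℝ} (hC : 0 ≤ C) (hF : 0 ≤ F) (hκ : 0 ≤ κ) (hD : D ≤ 1) :
    C * F ≤ C * Real.exp κ * Real.exp (-(κ * D)) * F := by
  have h1 : (1 : ℝ) ≤ Real.exp κ * Real.exp (-(κ * D)) := by
    rw [← Real.exp_add]
    exact Real.one_le_exp (by nlinarith [mul_le_mul_of_nonneg_left hD hκ])
  calc C * F = C * F * 1 := (mul_one _).symm
    _ ≤ C * F * (Real.exp κ * Real.exp (-(κ * D))) := mul_le_mul_of_nonneg_left h1 (mul_nonneg hC hF)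
    _ = C * Real.exp κ * Real.exp (-(κ * D)) * F := by ring

include hτ₂ hφ hη hU hc₀ hUb hMφ hMφ' hφn hφ' hJ in
/-- **`(L)(Δ^η(U)∘D_U; 2M_φM_φ′j₀e^κ, κ)` OVER ANY BLOCK MAP WITH ADJACENT BOND ENDS**: for a site field `λ` supported over `π⁻¹(v)` with `‖λ‖_∞ ≤ F` and every bond
`b`, `‖(Δ^η(U)D^η_Uλ)(b)‖ ≤ 2M_φM_φ′j₀·e^κ·e^{−κ·d_m(π(b₋), v)}·F` — the stencil lives on `λ(b₋)`, `λ(b₊)`, so it vanishes unless `π(b₋) = v` or `π(b₊) = v`, and then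
`d_m(π(b₋), v) ≤ 1`. [cite: Balaban1985BackgroundPropagators, (3.117) p.419, (3.36) p.396, Thm 3.1 (3.42) p.397] -/
theorem local_hessOp_covDerivL2K_of_blockMap (hπ : ∀ b : Bond d P, tdist m (π (bpos b)) (π (btgt b)) ≤ 1) {κ : ℝ} (hκ : 0 ≤ κ)
    (v : TSite d m) (s : SiteL2K ℂ d P c₀ W) (F : ℝ) (hsv : ∀ y, π y ≠ v → WL2.equiv ℂ _ W s y = 0) (hsF : ∀ y, ‖WL2.equiv ℂ _ W s y‖ ≤ F)
    (b : Bond d P) :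
    ‖WL2.equiv ℂ _ W (hessOp φ η U τ (covDerivL2K ℂ c₀ ((η : ℂ))⁻¹ (adTransportW φ U) s)) b‖ ≤
      2 * Mφ * Mφ' * j₀ * Real.exp κ * Real.exp (-(κ * tdist m (π (bpos b)) v)) * F := by
  have hF : 0 ≤ F := (norm_nonneg _).trans (hsF b.1)
  have hj₀ : 0 ≤ j₀ := (norm_nonneg _).trans (hJ b.2 b.1)
  have hC : 0 ≤ 2 * Mφ * Mφ' * j₀ := by positivity
  have hpt := norm_equiv_hessOp_covDerivL2K_le φ τ hτ₂ hφ hη hU hc₀ hUb hMφ' hφn hφ' hJ s b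
  -- the crude sup form of the stencil bound
  have hsup : ‖WL2.equiv ℂ _ W (hessOp φ η U τ (covDerivL2K ℂ c₀ ((η : ℂ))⁻¹ (adTransportW φ U) s)) b‖ ≤ 2 * Mφ * Mφ' * j₀ * F := by
    refine hpt.trans ?_
    calc Mφ' * j₀ * Mφ * (‖WL2.equiv ℂ _ W s b.1‖ + ‖WL2.equiv ℂ _ W s (shift b.2 b.1)‖) ≤ Mφ' * j₀ * Mφ * (F + F) :=
          mul_le_mul_of_nonneg_left (add_le_add (hsF _) (hsF _)) (mul_nonneg (mul_nonneg hMφ' hj₀) hMφ)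
      _ = 2 * Mφ * Mφ' * j₀ * F := by ring
  by_cases h₀ : π (bpos b) = v
  · rw [h₀, tdist_self]
    exact hsup.trans (le_exp_mul_exp hC hF hκ zero_le_one)
  · by_cases h₁ : π (btgt b) = v
    · have hD : tdist m (π (bpos b)) v ≤ 1 := by rw [← h₁]; exact hπ b
      exact hsup.trans (le_exp_mul_exp hC hF hκ hD)
    · rw [equiv_hessOp_covDerivL2K_eq_zero φ τ hτ₂ hφ hη hU hc₀ s b (hsv _ h₀) (hsv _ h₁), norm_zero]
      exact mul_nonneg (mul_nonneg (mul_nonneg hC (Real.exp_nonneg _)) (Real.exp_nonneg _)) hF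

include hτ₂ hφ hη hU hc₀ hUb hMφ' hφn hφ' hJ in
/-- LOCALITY of the transpose stencil (from the OWNER's pointwise letter): `(D*_U(Δ^η(U)A))(y) = 0` when `A` vanishes on the bonds `⟨y, y + e_μ⟩`, `⟨y − e_μ, y⟩`.
[cite: Balaban1985BackgroundPropagators, (3.117) p.419] -/
theorem equiv_covDivL2K_hessOp_eq_zero (A : BondL2K ℂ d P c₀ W) (y : TSite d P) (h₀ : ∀ μ, WL2.equiv ℂ _ W A (y, μ) = 0)
    (h₁ : ∀ μ, WL2.equiv ℂ _ W A (unshift μ y, μ) = 0) :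
    WL2.equiv ℂ _ W (covDivL2K ℂ c₀ ((η : ℂ))⁻¹ (adTransportW φ (fun b => (U b)⁻¹)) (hessOp φ η U τ A)) y = 0 := by
  have h := norm_equiv_covDivL2K_hessOp_le φ τ hτ₂ hφ hη hU hc₀ hUb hMφ' hφn hφ' hJ A y
  simp only [h₀, h₁, norm_zero, add_zero, Finset.sum_const_zero, mul_zero] at h
  exact norm_le_zero_iff.1 h

include hτ₂ hφ hη hU hc₀ hUb hMφ hMφ' hφn hφ' hJ in
/-- **`(L)(D*_U∘Δ^η(U); 2d·M_φM_φ′j₀e^κ, κ)` OVER ANY BLOCK MAP WITH ADJACENT BOND ENDS** (`1 ≤ m_i`): for a bond field `A` supported over the bonds with `π(b₋) = v`,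
`‖A‖_∞ ≤ F`, and every site `y`, `‖(D^{η*}_U(Δ^η(U)A))(y)‖ ≤ 2d·M_φM_φ′j₀·e^κ·e^{−κ·d_m(π(y), v)}·F` — the transpose stencil lives on the `2d` bonds touching `y`.
[cite: Balaban1985BackgroundPropagators, (3.117) p.419, (3.36) p.396, Thm 3.1 (3.42) p.397] -/
theorem local_covDivL2K_hessOp_of_blockMap (hm : ∀ i, 1 ≤ m i) (hπ : ∀ b : Bond d P, tdist m (π (bpos b)) (π (btgt b)) ≤ 1) {κ : ℝ} (hκ : 0 ≤ κ)
    (v : TSite d m) (A : BondL2K ℂ d P c₀ W) (F : ℝ) (hAv : ∀ b, π (bpos b) ≠ v → WL2.equiv ℂ _ W A b = 0) (hAF : ∀ b, ‖WL2.equiv ℂ _ W A b‖ ≤ F)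
    (y : TSite d P) :
    ‖WL2.equiv ℂ _ W (covDivL2K ℂ c₀ ((η : ℂ))⁻¹ (adTransportW φ (fun b => (U b)⁻¹)) (hessOp φ η U τ A)) y‖ ≤
      2 * d * Mφ * Mφ' * j₀ * Real.exp κ * Real.exp (-(κ * tdist m (π y) v)) * F := by
  by_cases hd : d = 0
  · subst hd
    -- no directions: `D*` of anything is an empty sum
    have h := norm_equiv_covDivL2K_hessOp_le φ τ hτ₂ hφ hη hU hc₀ hUb hMφ' hφn hφ' hJ A y
    rw [Finset.sum_of_isEmpty, mul_zero] at h
    rw [norm_le_zero_iff.1 h, norm_zero]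
    simp
  have hF : 0 ≤ F := (norm_nonneg _).trans (hAF (y, ⟨0, Nat.pos_of_ne_zero hd⟩))
  have hj₀ : 0 ≤ j₀ := (norm_nonneg _).trans (hJ ⟨0, Nat.pos_of_ne_zero hd⟩ y)
  have hC : 0 ≤ 2 * d * Mφ * Mφ' * j₀ := by positivity
  have hpt := norm_equiv_covDivL2K_hessOp_le φ τ hτ₂ hφ hη hU hc₀ hUb hMφ' hφn hφ' hJ A y
  have hsup : ‖WL2.equiv ℂ _ W (covDivL2K ℂ c₀ ((η : ℂ))⁻¹ (adTransportW φ (fun b => (U b)⁻¹)) (hessOp φ η U τ A)) y‖ ≤ 2 * d * Mφ * Mφ' * j₀ * F := by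
    refine hpt.trans ?_
    have hs : ∑ μ : Fin d, (‖WL2.equiv ℂ _ W A (y, μ)‖ + ‖WL2.equiv ℂ _ W A (unshift μ y, μ)‖) ≤ ∑ _μ : Fin d, (F + F) :=
      Finset.sum_le_sum fun μ _ => add_le_add (hAF _) (hAF _)
    rw [Finset.sum_const, Finset.card_univ, Fintype.card_fin, nsmul_eq_mul] at hs
    calc Mφ' * j₀ * Mφ * ∑ μ : Fin d, (‖WL2.equiv ℂ _ W A (y, μ)‖ + ‖WL2.equiv ℂ _ W A (unshift μ y, μ)‖) ≤ Mφ' * j₀ * Mφ * ((d : ℝ) * (F + F)) :=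
          mul_le_mul_of_nonneg_left hs (mul_nonneg (mul_nonneg hMφ' hj₀) hMφ)
      _ = 2 * d * Mφ * Mφ' * j₀ * F := by ring
  by_cases hy : π y = v
  · rw [hy, tdist_self]
    exact hsup.trans (le_exp_mul_exp hC hF hκ zero_le_one)
  · by_cases hex : ∃ μ, π (unshift μ y) = v
    · obtain ⟨μ, hμ⟩ := hex
      have hD : tdist m (π y) v ≤ 1 := by
        have h : tdist m (π (unshift μ y)) (π (shift μ (unshift μ y))) ≤ 1 := hπ (unshift μ y, μ)
        rw [shift_unshift] at h
        rw [← hμ, tdist_symm hm]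
        exact h
      exact hsup.trans (le_exp_mul_exp hC hF hκ hD)
    · simp only [not_exists] at hex
      rw [equiv_covDivL2K_hessOp_eq_zero φ τ hτ₂ hφ hη hU hc₀ hUb hMφ' hφn hφ' hJ A y (fun μ => hAv (y, μ) hy)
        (fun μ => hAv (unshift μ y, μ) (hex μ)), norm_zero]
      exact mul_nonneg (mul_nonneg (mul_nonneg hC (Real.exp_nonneg _)) (Real.exp_nonneg _)) hF

end BlockMap

/-! ## §2 Over the big blocks of the tower: the hypotheses `hM`, `hMt` of (K72) `transfer_pair` -/

section Tower

variable {d : ℕ} (L : ℕ) [NeZero L] (m : Fin d → ℕ) (k : ℕ) {𝔸 : Type*} [NormedRing 𝔸] [NormedAlgebra ℂ 𝔸] [NormOneClass 𝔸] [StarRing 𝔸] [StarModule ℂ 𝔸]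
  {W : Type*} [NormedAddCommGroup W] [InnerProductSpace ℂ W] [FiniteDimensional ℂ W] (φ : W ≃ₗ[ℂ] 𝔸) {c₀ : ℝ} [Fact (0 < c₀)]
  (τ : 𝔸 →ₗ[ℂ] ℂ) (hτ₂ : ∀ X Y : 𝔸, τ (X * Y) = τ (Y * X))
  (hφ : ∀ X Y : 𝔸, ⟪φ.symm X, φ.symm Y⟫_ℂ = τ (star X * Y)) {η : ℝ} (hη : η ≠ 0) {U : Bond d (towerP L m k) → 𝔸ˣ}
  (hU : ∀ b, star (U b : 𝔸) = ((U b)⁻¹ : 𝔸ˣ)) (hc₀ : c₀ = η ^ d) (hUb : ∀ b, U b ∈ U1 𝔸)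
  {Mφ Mφ' j₀ : ℝ} (hMφ : 0 ≤ Mφ) (hMφ' : 0 ≤ Mφ') (hφn : ∀ w, ‖φ w‖ ≤ Mφ * ‖w‖) (hφ' : ∀ X, ‖φ.symm X‖ ≤ Mφ' * ‖X‖)
  (hJ : ∀ μ y, ‖B9Eq39Adjoint.J (fun μ => B9Eq33CovDerivVector.shiftEquiv μ) (fun μ y => U (y, μ)) η μ y‖ ≤ j₀)

include hτ₂ hφ hη hU hc₀ hUb hMφ hMφ' hφn hφ' hJ in
/-- **`hM` OF (K72) AT THE TOWER — `(L)(Δ^η(U)∘D_U; 2M_φM_φ′j₀e^κ, κ)`** over the big blocks `Π = blockCoord (L^k) m ∘ siteCast` of `T_{(L^k m)}` (sites read at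
`Π`, bonds at `Π∘b₋`, block distance `d_m`), every `κ ≥ 0`. [cite: Balaban1985BackgroundPropagators, (3.117) p.419, (3.36) p.396, Thm 3.1 (3.42) p.397, (3.130) p.421] -/
theorem local_hessOp_covDerivL2K_tower (hm : ∀ i, 1 ≤ m i) {κ : ℝ} (hκ : 0 ≤ κ) (v : TSite d m) (s : SiteL2K ℂ d (towerP L m k) c₀ W) (F : ℝ)
    (hsv : ∀ y, blockCoord (L ^ k) m (siteCast (towerP_eq_fineP_pow L m k) y) ≠ v → WL2.equiv ℂ _ W s y = 0)
    (hsF : ∀ y, ‖WL2.equiv ℂ _ W s y‖ ≤ F) (b : Bond d (towerP L m k)) :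
    ‖WL2.equiv ℂ _ W (hessOp φ η U τ (covDerivL2K ℂ c₀ ((η : ℂ))⁻¹ (adTransportW φ U) s)) b‖ ≤
      2 * Mφ * Mφ' * j₀ * Real.exp κ *
        Real.exp (-(κ * tdist m (blockCoord (L ^ k) m (siteCast (towerP_eq_fineP_pow L m k) (bpos b))) v)) * F :=
  local_hessOp_covDerivL2K_of_blockMap φ τ hτ₂ hφ hη hU hc₀ hUb hMφ hMφ' hφn hφ' hJ
    (fun y : TSite d (towerP L m k) => blockCoord (L ^ k) m (siteCast (towerP_eq_fineP_pow L m k) y))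
    (tdist_bigBlock_bpos_btgt_le_one L m k hm) hκ v s F hsv hsF b

include hτ₂ hφ hη hU hc₀ hUb hMφ hMφ' hφn hφ' hJ in
/-- **`hMt` OF (K72) AT THE TOWER — `(L)(D*_U∘Δ^η(U); 2d·M_φM_φ′j₀e^κ, κ)`** over the big blocks of `T_{(L^k m)}` (bonds read at `Π∘b₋`, sites at `Π`), every `κ ≥ 0`.
[cite: Balaban1985BackgroundPropagators, (3.117) p.419, (3.36) p.396, Thm 3.1 (3.42) p.397, (3.130) p.421] -/
theorem local_covDivL2K_hessOp_tower (hm : ∀ i, 1 ≤ m i) {κ : ℝ} (hκ : 0 ≤ κ) (v : TSite d m) (A : BondL2K ℂ d (towerP L m k) c₀ W) (F : ℝ)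
    (hAv : ∀ b, blockCoord (L ^ k) m (siteCast (towerP_eq_fineP_pow L m k) (bpos b)) ≠ v → WL2.equiv ℂ _ W A b = 0)
    (hAF : ∀ b, ‖WL2.equiv ℂ _ W A b‖ ≤ F) (y : TSite d (towerP L m k)) :
    ‖WL2.equiv ℂ _ W (covDivL2K ℂ c₀ ((η : ℂ))⁻¹ (adTransportW φ (fun b => (U b)⁻¹)) (hessOp φ η U τ A)) y‖ ≤
      2 * d * Mφ * Mφ' * j₀ * Real.exp κ *
        Real.exp (-(κ * tdist m (blockCoord (L ^ k) m (siteCast (towerP_eq_fineP_pow L m k) y)) v)) * F :=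
  local_covDivL2K_hessOp_of_blockMap φ τ hτ₂ hφ hη hU hc₀ hUb hMφ hMφ' hφn hφ' hJ
    (fun y : TSite d (towerP L m k) => blockCoord (L ^ k) m (siteCast (towerP_eq_fineP_pow L m k) y))
    hm (tdist_bigBlock_bpos_btgt_le_one L m k hm) hκ v A F hAv hAF y

end Tower

end Literature.MathematicalPhysics.QuantumFieldTheory.Balaban1983to89.B9Eq3117GaugeModeStencilLettersTower

end
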